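/-
Copyright (c) 2026. All rights reserved.
Released under Apache 2.0 license as described in the file LICENSE.
Authors: abc-iut cell, wave-6 cone prover seat abc-iut-w6-d036 (gen 5), over abc-iut-L4-t9's model categories and
this seat's canonical transport (see the imports).
-/
import Literature.AnabelianGeometry.AbsoluteAnabelian.MLFGaloisMonoAnabelianTransport
import Literature.AnabelianGeometry.AbsoluteAnabelian.MonoidKummerMapsTCGLiftProofs
import Literature.AnabelianGeometry.AbsoluteAnabelian.AbsTopIII.MLFGaloisModelCategories
import Mathlib.FieldTheory.KrullTopology
import Mathlib.Topology.Algebra.MulAction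
import HarnessLib

/-!
# [AbsTopIII] Prop 5.8 (i)/(ii) AT A GENUINE MONO-ANALYTIC BASE: the groupoid of absolute Galois groups of MLFs
# with ALL isomorphisms of topological groups, and the FUNCTORIAL containers `G ↦ (G ↷ k̄^×(G))`, `G ↦ (G ↷ 𝒪^×_k̄(G))`

S. Mochizuki, *Topics in absolute anabelian geometry III: global reconstruction algorithms*, J. Math. Sci. Univ.
Tokyo 22 (2015) 939–1156 [MochizukiAbsTopIII2015]; locators = pages of the author's manuscript
(`paper:url-5493eb38cbb7`), read on the page: Def 3.1 (iii) p. 68 (double-underlined `𝒯𝔾`, `𝒞^{MLF⊢}_T`: "the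
various subcategories determined by the isomorphisms"; "of mono-analytic type"), Def 5.6 (i) p. 134 (`TG⊢`), Def 5.6
(ii)(b) p. 135 ("`G_w` is isomorphic to the [group-theoretically characterizable] quotient `Π_v ↠ G_v` determined by
the absolute Galois group of the base field"), Prop 5.8 (i)/(ii) p. 139 ("a functorial [i.e., relative to `TG⊢`]
“group-theoretic” algorithm “`Ob(TG⊢) ∋ G ↦ Γ⃗×_non(G)`” for constructing from `G` the `Γ⃗×_non`-diagram in
`𝒞^{MLF⊢}_{TS⊞}` `𝒪^×_k̄(G) ↪ k̄^×(G)` …"), Prop 5.8 (vii) p. 141–142 (the forgetful functors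
`ψ^{An⊢⊞}_{w,ν} : An⊢[𝒩⊢⊞_w] → 𝒩⊢⊞_w` and `ι^{An⊢⊞}_{w,ε}`).

## What this file builds (kernel constructions; node [AbsTopIII] Prop 5.8 (vii) of the abc-iut cone, layer L4)

The §5 settings with genuine components in the tree (abc-iut-w4-d095's `LogFrobeniusSetting.nonarchGenuineMono p`)
realise the mono-analytic base `ℰ⊢` as abc-iut-L4-t9's double-underlined `𝒯𝔾` (ALL topological groups) and declare the
forgetful functors `ψ^{An⊢⊞}_{w,ν}` a PLACEHOLDER (`G ↦ (G ↷ pt)`, `TopGroupObj.trivialTS`): the genuine containers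
`G ↦ (G ↷ k̄^×(G))` need local class field theory FUNCTORIALLY IN ISOMORPHISMS OF `G`.  Here:

* `MLFClosure.MonoBase` — the GENUINE mono-analytic base at a nonarchimedean place: the full subgroupoid of
  double-underlined `𝒯𝔾` on the absolute Galois groups `G_k = Gal(k̄/k)` of MLF closure data (objects indexed by
  abc-iut-L4-t2's `MLFClosure`, morphisms `C₁ ⟶ C₂` = ALL isomorphisms of topological groups `G_{k₁} ⥲ G_{k₂}` — the
  field is FORGOTTEN by the morphisms; `InducedCategory` along `MLFClosure.galObj`);
* `MLFClosure.timesObj C = (G_k ↷ k̄^×)`, `MLFClosure.unitsObj C = (G_k ↷ 𝒪^×_k̄)` as objects of abc-iut-L4-t9's `𝒞_TS`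
  (`TSObj`; discrete arithmetic data, continuity = open stabilisers in the Krull topology), both OF MONO-ANALYTIC TYPE
  (`timesObj_actionKer`, `unitsObj_actionKer`: the action kernels are trivial);
* **the functors `MLFClosure.kbarTimes`, `MLFClosure.kbarUnits : MonoBase ⥤ 𝒞_TS`** — on a morphism `α : G_{k₁} ⥲ G_{k₂}`
  the CANONICAL transport `(α, β_α)` of `MLFGaloisMonoAnabelianTransport.lean` (functoriality = `transport_refl` /
  `transport_trans`) — and the natural transformation `kbarUnitsToTimes : kbarUnits ⟶ kbarTimes` (the edge
  `𝒪^×_k̄(G) ↪ k̄^×(G)` of `Γ⃗×_non(G)`; naturality = the transport preserves units), lying over the base ON THE NOSE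
  (`kbarTimes_gal`, `kbarUnits_gal`).

These are the vertices `𝒪^×`, `k̄^×` of the functorial algorithm of Prop 5.8 (ii) and the morphism/naturality content of
`ψ^{An⊢⊞}_{w,ν}`, `ι^{An⊢⊞}_{w,ε}` of Prop 5.8 (vii), at a genuine carrier.  HONEST FRAMING: MODEL-LEVEL (one
nonarchimedean place; arithmetic data discrete per Rmk 3.1.1; the perfection vertices `k~`, `(k̄^×)^pf` and the global
theaters are not built here); classical local class field theory as proved in the tree; refereed pre-IUT material;
nothing here bears on [IUTchIII] Cor. 3.12; no side taken.
-/

set_option autoImplicit false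

noncomputable section

namespace Literature.AnabelianGeometry.AbsoluteAnabelian

open CategoryTheory AbsTopIII
open scoped nonZeroDivisors

namespace MLFClosure

/-! ## The Galois group of MLF closure data as an object of double-underlined `𝒯𝔾` -/

/-- `G_k = Gal(k̄/k)` (Krull topology) of MLF closure data `C = (k, k̄)`, as an object of abc-iut-L4-t9's
double-underlined `𝒯𝔾`. [cite: MochizukiAbsTopIII2015, Definition 5.6 (i) p.134] -/
def galObj (C : MLFClosure.{0}) : TopGroupObj := ⟨C.K ≃ₐ[C.k] C.K⟩

/-- `galObj` is `Gal(k̄/k)`. [cite: MochizukiAbsTopIII2015, Definition 5.6 (i) p.134] -/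
@[simp] theorem galObj_G (C : MLFClosure.{0}) : (galObj C).G = (C.K ≃ₐ[C.k] C.K) := rfl

/-- **The genuine mono-analytic base** at a nonarchimedean place: MLF closure data with, as morphisms `C₁ ⟶ C₂`, ALL
isomorphisms of topological groups `G_{k₁} ⥲ G_{k₂}` — the full subgroupoid of double-underlined `𝒯𝔾` on absolute Galois
groups of MLFs ("`Orb(TG⊢)`" at the place, with the isomorphism reading of Def 3.1 (iii)); the field structure is invisible
to the morphisms. [cite: MochizukiAbsTopIII2015, Definition 5.6 (ii) p.135] -/
abbrev MonoBase : Type 1 := InducedCategory TopGroupObj galObj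

/-- Pointwise stabilisers of `Gal(k̄/k) ↷ k̄` are open in the Krull topology (the continuity of the Galois action on
the arithmetic data of Def 3.1 (i): "a continuous action of `Π` on `M`"). [cite: MochizukiAbsTopIII2015, Definition 3.1 (i) p.67] -/
theorem isOpen_stabilizer (C : MLFClosure.{0}) (x : C.K) :
    IsOpen (MulAction.stabilizer (C.K ≃ₐ[C.k] C.K) x : Set (C.K ≃ₐ[C.k] C.K)) := by
  haveI : FiniteDimensional C.k (IntermediateField.adjoin C.k {x}) :=
    IntermediateField.adjoin.finiteDimensional (Algebra.IsIntegral.isIntegral x)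
  have h : IsOpen ((IntermediateField.adjoin C.k {x}).fixingSubgroup : Set (C.K ≃ₐ[C.k] C.K)) :=
    IntermediateField.fixingSubgroup_isOpen (IntermediateField.adjoin C.k {x})
  refine Subgroup.isOpen_mono (H₁ := (IntermediateField.adjoin C.k {x}).fixingSubgroup) ?_ h
  intro τ hτ
  exact MulAction.mem_stabilizer_iff.mpr
    ((IntermediateField.mem_fixingSubgroup_iff _ _).mp hτ x
      (IntermediateField.subset_adjoin C.k {x} (Set.mem_singleton x)))

/-! ## The containers `(G_k ↷ k̄^×)` and `(G_k ↷ 𝒪^×_k̄)` as `TS`-pairs of mono-analytic type -/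

/-- The action of `Gal(k̄/k)` on `k̄^×` (non-zero-divisors of `k̄`). [cite: MochizukiAbsTopIII2015, Definition 3.1 (i) p.67] -/
@[reducible] def timesAction (C : MLFClosure.{0}) : MulAction (C.K ≃ₐ[C.k] C.K) ↥(C.K)⁰ where
  smul σ x := ⟨σ • (x : C.K), smul_mem_nonZeroDivisors σ x.2⟩
  one_smul x := Subtype.ext (one_smul _ (x : C.K))
  mul_smul σ τ x := Subtype.ext (mul_smul σ τ (x : C.K))

/-- The action of `Gal(k̄/k)` on `𝒪^×_k̄`. [cite: MochizukiAbsTopIII2015, Definition 3.1 (i) p.67] -/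
@[reducible] def unitsAction (C : MLFClosure.{0}) : MulAction (C.K ≃ₐ[C.k] C.K) ↥(unitSubmonoid C.k C.K) where
  smul σ x := ⟨σ • (x : C.K), smul_mem_unitSubmonoid σ x.2⟩
  one_smul x := Subtype.ext (one_smul _ (x : C.K))
  mul_smul σ τ x := Subtype.ext (mul_smul σ τ (x : C.K))

/-- **`(G_k ↷ k̄^×)`** — the vertex `k̄^×(G)` of `Γ⃗×_non(G)` at `G = G_k` — as a `TS`-pair (arithmetic datum discrete,
Rmk 3.1.1; continuity of the action = openness of stabilisers). [cite: MochizukiAbsTopIII2015, Prop 5.8 (ii) p. 139] -/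
def timesPair (C : MLFClosure.{0}) : GaloisSpacePair.{0} :=
  letI : TopologicalSpace ↥(C.K)⁰ := ⊥
  haveI : DiscreteTopology ↥(C.K)⁰ := ⟨rfl⟩
  haveI : LocallyCompactSpace ↥(C.K)⁰ :=
    ⟨fun x _ hn => ⟨{x}, by rw [nhds_discrete]; exact Filter.mem_pure.2 rfl,
      Set.singleton_subset_iff.2 (mem_of_mem_nhds hn), isCompact_singleton⟩⟩
  letI : MulAction (C.K ≃ₐ[C.k] C.K) ↥(C.K)⁰ := timesAction C
  { Pi := C.K ≃ₐ[C.k] C.K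
    M := ↥(C.K)⁰
    continuous_smul :=
      ((continuousSMul_iff_stabilizer_isOpen (M := C.K ≃ₐ[C.k] C.K) (X := ↥(C.K)⁰)).2 fun x => by
        convert C.isOpen_stabilizer (x : C.K) using 1
        ext σ
        exact Subtype.ext_iff).continuous_smul }

/-- **`(G_k ↷ 𝒪^×_k̄)`** — the vertex `𝒪^×_k̄(G)` of `Γ⃗×_non(G)` at `G = G_k` — as a `TS`-pair.
[cite: MochizukiAbsTopIII2015, Prop 5.8 (ii) p. 139] -/
def unitsPair (C : MLFClosure.{0}) : GaloisSpacePair.{0} :=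
  letI : TopologicalSpace ↥(unitSubmonoid C.k C.K) := ⊥
  haveI : DiscreteTopology ↥(unitSubmonoid C.k C.K) := ⟨rfl⟩
  haveI : LocallyCompactSpace ↥(unitSubmonoid C.k C.K) :=
    ⟨fun x _ hn => ⟨{x}, by rw [nhds_discrete]; exact Filter.mem_pure.2 rfl,
      Set.singleton_subset_iff.2 (mem_of_mem_nhds hn), isCompact_singleton⟩⟩
  letI : MulAction (C.K ≃ₐ[C.k] C.K) ↥(unitSubmonoid C.k C.K) := unitsAction C
  { Pi := C.K ≃ₐ[C.k] C.K
    M := ↥(unitSubmonoid C.k C.K)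
    continuous_smul :=
      ((continuousSMul_iff_stabilizer_isOpen (M := C.K ≃ₐ[C.k] C.K) (X := ↥(unitSubmonoid C.k C.K))).2
        fun x => by
        convert C.isOpen_stabilizer (x : C.K) using 1
        ext σ
        exact Subtype.ext_iff).continuous_smul }

/-- `(G_k ↷ k̄^×)` as an object of abc-iut-L4-t9's `𝒞_TS`. [cite: MochizukiAbsTopIII2015, Prop 5.8 (ii) p. 139] -/
def timesObj (C : MLFClosure.{0}) : TSObj := ⟨timesPair C⟩

/-- `(G_k ↷ 𝒪^×_k̄)` as an object of `𝒞_TS`. [cite: MochizukiAbsTopIII2015, Prop 5.8 (ii) p. 139] -/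
def unitsObj (C : MLFClosure.{0}) : TSObj := ⟨unitsPair C⟩

/-- The arithmetic datum of `(G_k ↷ k̄^×)` IS `k̄^×` and its Galois group IS `Gal(k̄/k)`.
[cite: MochizukiAbsTopIII2015, Prop 5.8 (ii) p. 139] -/
theorem timesObj_M_Pi (C : MLFClosure.{0}) :
    (timesObj C).pair.M = ↥(C.K)⁰ ∧ (timesObj C).pair.Pi = (C.K ≃ₐ[C.k] C.K) := ⟨rfl, rfl⟩

/-- The arithmetic datum of `(G_k ↷ 𝒪^×_k̄)` IS `𝒪^×_k̄` and its Galois group IS `Gal(k̄/k)`.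
[cite: MochizukiAbsTopIII2015, Prop 5.8 (ii) p. 139] -/
theorem unitsObj_M_Pi (C : MLFClosure.{0}) :
    (unitsObj C).pair.M = ↥(unitSubmonoid C.k C.K) ∧ (unitsObj C).pair.Pi = (C.K ≃ₐ[C.k] C.K) := ⟨rfl, rfl⟩

/-- The action in `(G_k ↷ k̄^×)` on values: `σ · x = σ(x)`. [cite: MochizukiAbsTopIII2015, Definition 3.1 (i) p.67] -/
theorem timesObj_smul_val (C : MLFClosure.{0}) (σ : (timesObj C).pair.Pi) (x : (timesObj C).pair.M) :
    (σ • x).1 = (show C.K ≃ₐ[C.k] C.K from σ) x.1 := rfl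

/-- The action in `(G_k ↷ 𝒪^×_k̄)` on values. [cite: MochizukiAbsTopIII2015, Definition 3.1 (i) p.67] -/
theorem unitsObj_smul_val (C : MLFClosure.{0}) (σ : (unitsObj C).pair.Pi) (x : (unitsObj C).pair.M) :
    (σ • x).1 = (show C.K ≃ₐ[C.k] C.K from σ) x.1 := rfl

/-- The arithmetic datum of `(G_k ↷ k̄^×)` is discrete (Rmk 3.1.1 convention). [cite: MochizukiAbsTopIII2015, Remark 3.1.1 p.70] -/
theorem timesObj_discreteTopology (C : MLFClosure.{0}) : DiscreteTopology (timesObj C).pair.M := ⟨rfl⟩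

/-- The arithmetic datum of `(G_k ↷ 𝒪^×_k̄)` is discrete. [cite: MochizukiAbsTopIII2015, Remark 3.1.1 p.70] -/
theorem unitsObj_discreteTopology (C : MLFClosure.{0}) : DiscreteTopology (unitsObj C).pair.M := ⟨rfl⟩

/-- `(G_k ↷ k̄^×)` is OF MONO-ANALYTIC TYPE: `G_k` acts faithfully on `k̄^×` (Def 3.1 (ii): the Galois augmentation is an
isomorphism). [cite: MochizukiAbsTopIII2015, Definition 3.1 (ii) p.67] -/
theorem timesObj_actionKer (C : MLFClosure.{0}) : (timesObj C).actionKer = ⊥ := by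
  rw [eq_bot_iff]
  intro σ hσ
  rw [TSObj.mem_actionKer_iff] at hσ
  rw [Subgroup.mem_bot]
  apply AlgEquiv.ext
  intro y
  by_cases hy : y = 0
  · rw [hy, map_zero]; rfl
  · exact congrArg Subtype.val (hσ ⟨y, mem_nonZeroDivisors_of_ne_zero hy⟩)

/-- `(G_k ↷ 𝒪^×_k̄)` is OF MONO-ANALYTIC TYPE: `G_k` acts faithfully on `𝒪^×_k̄` (abc-iut-L6-t13's
`MLFClosure.algEquiv_eq_one_of_forall_unitSubmonoid`). [cite: MochizukiAbsTopIII2015, Definition 3.1 (ii) p.67] -/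
theorem unitsObj_actionKer (C : MLFClosure.{0}) : (unitsObj C).actionKer = ⊥ := by
  rw [eq_bot_iff]
  intro σ hσ
  rw [TSObj.mem_actionKer_iff] at hσ
  rw [Subgroup.mem_bot]
  exact C.algEquiv_eq_one_of_forall_unitSubmonoid σ fun x hx => congrArg Subtype.val (hσ ⟨x, hx⟩)

/-! ## Morphisms of `𝒞_TS` from equivariant bijections over isomorphisms of groups -/

/-- A `TS`-morphism between pairs with trivial action kernels from an isomorphism of topological groups and an equivariant
map of (discrete) arithmetic data. [cite: MochizukiAbsTopIII2015, Definition 3.1 (ii) p.67] -/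
def homOfEquivariant {P Q : TSObj} (hP : P.actionKer = ⊥) (hQ : Q.actionKer = ⊥) (hd : DiscreteTopology P.pair.M)
    (α : P.pair.Pi ≃ₜ* Q.pair.Pi) (f : P.pair.M → Q.pair.M) (hf : ∀ (g : P.pair.Pi) (x : P.pair.M), f (g • x) = α g • f x) :
    P ⟶ Q where
  homPi := α.toMonoidHom
  continuous_homPi := α.continuous
  bijective_homPi := α.bijective
  isOpenMap_homPi := α.toHomeomorph.isOpenMap
  homM := f
  continuous_homM := continuous_of_discreteTopology
  smul_comm := hf
  comap_ker := by
    rw [hP, hQ]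
    ext g
    simp only [Subgroup.mem_comap, Subgroup.mem_bot]
    exact map_eq_one_iff _ α.injective

/-! ## The functorial containers on the mono-analytic base -/

/-- The underlying isomorphism of topological Galois groups of a morphism of `MonoBase`.
[cite: MochizukiAbsTopIII2015, Definition 5.6 (ii) p.135] -/
abbrev homIso {C₁ C₂ : MonoBase} (f : C₁ ⟶ C₂) : (C₁.K ≃ₐ[C₁.k] C₁.K) ≃ₜ* (C₂.K ≃ₐ[C₂.k] C₂.K) := f.hom.iso

/-- The canonical transport restricted to units: `β_α : 𝒪^×_{k̄₁} ⥲ 𝒪^×_{k̄₂}` (as a function; `transport_mem_unitSubmonoid_iff`).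
[cite: MochizukiAbsTopIII2015, Prop 5.8 (ii) p. 139] -/
def unitsTransport {C₁ C₂ : MLFClosure.{0}} (α : (C₁.K ≃ₐ[C₁.k] C₁.K) ≃ₜ* (C₂.K ≃ₐ[C₂.k] C₂.K))
    (x : ↥(unitSubmonoid C₁.k C₁.K)) : ↥(unitSubmonoid C₂.k C₂.K) :=
  ⟨(transport α ⟨(x : C₁.K), mem_nonZeroDivisors_of_ne_zero ((AbsoluteAnabelian.mem_unitSubmonoid_iff C₁.k C₁.K).mp x.2).1⟩ :
      C₂.K),
    (transport_mem_unitSubmonoid_iff α _).mp x.2⟩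

/-- `unitsTransport` on values is the transport. [cite: MochizukiAbsTopIII2015, Prop 5.8 (ii) p. 139] -/
@[simp] theorem coe_unitsTransport {C₁ C₂ : MLFClosure.{0}} (α : (C₁.K ≃ₐ[C₁.k] C₁.K) ≃ₜ* (C₂.K ≃ₐ[C₂.k] C₂.K))
    (x : ↥(unitSubmonoid C₁.k C₁.K)) :
    (unitsTransport α x : C₂.K) =
      (transport α ⟨(x : C₁.K), mem_nonZeroDivisors_of_ne_zero
        ((AbsoluteAnabelian.mem_unitSubmonoid_iff C₁.k C₁.K).mp x.2).1⟩ : C₂.K) := rfl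

/-- **The functorial container `G ↦ (G ↷ k̄^×(G))` on the genuine mono-analytic base** (Prop 5.8 (ii), vertex `k̄^×`;
the object/morphism part of `ψ^{An⊢⊞}_{w,×}` of Prop 5.8 (vii)): `C ↦ (G_k ↷ k̄^×)`, and an isomorphism of topological
groups `α : G_{k₁} ⥲ G_{k₂}` goes to the `TS`-isomorphism `(α, β_α)` with `β_α` the canonical transport; functoriality is
`transport_refl` / `transport_trans`. [cite: MochizukiAbsTopIII2015, Prop 5.8 (vii) p.141] -/
def kbarTimes : MonoBase ⥤ TSObj where
  obj C := timesObj C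
  map {C₁ C₂} f := homOfEquivariant (timesObj_actionKer C₁) (timesObj_actionKer C₂) (timesObj_discreteTopology C₁)
    (homIso f) (transport (homIso f)) fun g x => Subtype.ext (transport_smul (homIso f) g x)
  map_id C := by
    refine TSObj.Hom.ext (MonoidHom.ext fun _ => rfl) (funext fun x => ?_)
    change transport (ContinuousMulEquiv.refl _) (show ↥(C.K)⁰ from x) = (show ↥(C.K)⁰ from x)
    rw [transport_refl]
    rfl
  map_comp {C₁ C₂ C₃} f g := by
    refine TSObj.Hom.ext (MonoidHom.ext fun _ => rfl) (funext fun x => ?_)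
    change transport ((homIso f).trans (homIso g)) (show ↥(C₁.K)⁰ from x) =
      transport (homIso g) (transport (homIso f) (show ↥(C₁.K)⁰ from x))
    rw [transport_trans]
    rfl

/-- **The functorial container `G ↦ (G ↷ 𝒪^×_k̄(G))`** (Prop 5.8 (ii), vertex `𝒪^×`; `ψ^{An⊢⊞}_{w,𝒪^×}` of Prop 5.8 (vii)).
[cite: MochizukiAbsTopIII2015, Prop 5.8 (vii) p.141] -/
def kbarUnits : MonoBase ⥤ TSObj where
  obj C := unitsObj C
  map {C₁ C₂} f := homOfEquivariant (unitsObj_actionKer C₁) (unitsObj_actionKer C₂) (unitsObj_discreteTopology C₁)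
    (homIso f) (unitsTransport (homIso f)) fun g x => Subtype.ext (transport_smul (homIso f) g
      ⟨x.1, mem_nonZeroDivisors_of_ne_zero ((AbsoluteAnabelian.mem_unitSubmonoid_iff C₁.k C₁.K).mp x.2).1⟩)
  map_id C := by
    refine TSObj.Hom.ext (MonoidHom.ext fun _ => rfl) (funext fun x => Subtype.ext ?_)
    change (unitsTransport (ContinuousMulEquiv.refl _) (show ↥(unitSubmonoid C.k C.K) from x)).1 =
      (show ↥(unitSubmonoid C.k C.K) from x).1
    rw [coe_unitsTransport, transport_refl]
    rfl
  map_comp {C₁ C₂ C₃} f g := by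
    refine TSObj.Hom.ext (MonoidHom.ext fun _ => rfl) (funext fun x => Subtype.ext ?_)
    change (unitsTransport ((homIso f).trans (homIso g)) (show ↥(unitSubmonoid C₁.k C₁.K) from x)).1 =
      (unitsTransport (homIso g) (unitsTransport (homIso f) (show ↥(unitSubmonoid C₁.k C₁.K) from x))).1
    simp only [coe_unitsTransport, transport_trans, MulEquiv.trans_apply, Subtype.coe_eta]

/-- `kbarTimes` on objects is `(G_k ↷ k̄^×)`. [cite: MochizukiAbsTopIII2015, Prop 5.8 (ii) p. 139] -/
@[simp] theorem kbarTimes_obj (C : MonoBase) : kbarTimes.obj C = timesObj C := rfl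

/-- `kbarUnits` on objects is `(G_k ↷ 𝒪^×_k̄)`. [cite: MochizukiAbsTopIII2015, Prop 5.8 (ii) p. 139] -/
@[simp] theorem kbarUnits_obj (C : MonoBase) : kbarUnits.obj C = unitsObj C := rfl

/-- `kbarTimes` on a morphism: the Galois component IS the given isomorphism `α`.
[cite: MochizukiAbsTopIII2015, Prop 5.8 (vii) p.141] -/
theorem kbarTimes_map_homPi_apply {C₁ C₂ : MonoBase} (f : C₁ ⟶ C₂) (g : C₁.K ≃ₐ[C₁.k] C₁.K) :
    (kbarTimes.map f).homPi g = homIso f g := rfl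

/-- `kbarTimes` on a morphism: the arithmetic component IS the canonical transport `β_α`.
[cite: MochizukiAbsTopIII2015, Prop 5.8 (vii) p.141] -/
theorem kbarTimes_map_homM_apply {C₁ C₂ : MonoBase} (f : C₁ ⟶ C₂) (x : ↥(C₁.K)⁰) :
    (kbarTimes.map f).homM x = transport (homIso f) x := rfl

/-- **The edge `𝒪^×_k̄(G) ↪ k̄^×(G)` of `Γ⃗×_non(G)` is NATURAL on the mono-analytic base** — the natural transformation
`ι^{An⊢⊞}_{w,ε}` of Prop 5.8 (vii) along that edge at the genuine carrier: naturality in an arbitrary isomorphism of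
topological Galois groups `α` = the canonical transport carries units to units. [cite: MochizukiAbsTopIII2015, Prop 5.8 (vii) p.142] -/
def kbarUnitsToTimes : kbarUnits ⟶ kbarTimes where
  app C := homOfEquivariant (unitsObj_actionKer C) (timesObj_actionKer C) (unitsObj_discreteTopology C)
    (ContinuousMulEquiv.refl _)
    (fun x => (⟨x.1, mem_nonZeroDivisors_of_ne_zero ((AbsoluteAnabelian.mem_unitSubmonoid_iff C.k C.K).mp x.2).1⟩ :
      ↥(C.K)⁰))
    fun _ _ => rfl
  naturality _ _ _ := TSObj.Hom.ext (MonoidHom.ext fun _ => rfl) (funext fun _ => Subtype.ext rfl)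

/-- `kbarTimes` lies over the base ON THE NOSE: `(G_k ↷ k̄^×) ↦ G_k` recovers the inclusion `MonoBase → 𝒯𝔾` (the fibred
product condition of `𝒩⊢⊞_w = Orb(𝒞^{MLF⊢}_{TS⊞}) ×_{Orb(TG⊢)} Th⊢[Z]`, Def 5.6 (iii)). [cite: MochizukiAbsTopIII2015, Definition 5.6 (iii) p.136] -/
def kbarTimes_gal : kbarTimes ⋙ TSObj.gal ≅ inducedFunctor galObj :=
  NatIso.ofComponents (fun _ => Iso.refl _) fun _ => TopGroupObj.Hom.ext fun _ => rfl

/-- `kbarUnits` lies over the base ON THE NOSE. [cite: MochizukiAbsTopIII2015, Definition 5.6 (iii) p.136] -/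
def kbarUnits_gal : kbarUnits ⋙ TSObj.gal ≅ inducedFunctor galObj :=
  NatIso.ofComponents (fun _ => Iso.refl _) fun _ => TopGroupObj.Hom.ext fun _ => rfl

/-- Every morphism of the mono-analytic base is invertible (it is a groupoid: isomorphisms of topological groups).
[cite: MochizukiAbsTopIII2015, Definition 3.1 (iii) p.68] -/
def MonoBase.isoOfHom {C₁ C₂ : MonoBase} (f : C₁ ⟶ C₂) : C₁ ≅ C₂ where
  hom := f
  inv := InducedCategory.homMk (TopGroupObj.isoOfHom f.hom).inv
  hom_inv_id := InducedCategory.hom_ext (TopGroupObj.isoOfHom f.hom).hom_inv_id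
  inv_hom_id := InducedCategory.hom_ext (TopGroupObj.isoOfHom f.hom).inv_hom_id

/-- **Summary (Prop 5.8 (ii) functorial, vertices `𝒪^× ↪ k̄^×`, at the genuine base)**: there are functors
`MonoBase ⥤ 𝒞_TS` lying over `MonoBase → 𝒯𝔾` whose values are the genuine containers `(G_k ↷ 𝒪^×_k̄) ↪ (G_k ↷ k̄^×)` of
mono-analytic type, joined by a natural transformation — NO placeholder. [cite: MochizukiAbsTopIII2015, Prop 5.8 (ii) p. 139] -/
theorem exists_genuine_containers :
    ∃ (U T : MonoBase ⥤ TSObj) (_ : U ⟶ T),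
      Nonempty (T ⋙ TSObj.gal ≅ inducedFunctor galObj) ∧ Nonempty (U ⋙ TSObj.gal ≅ inducedFunctor galObj) ∧
      (∀ C : MonoBase, (T.obj C).actionKer = ⊥ ∧ (U.obj C).actionKer = ⊥) ∧
      (∀ C : MonoBase, (T.obj C).pair.M = ↥(C.K)⁰ ∧ (U.obj C).pair.M = ↥(unitSubmonoid C.k C.K)) :=
  ⟨kbarUnits, kbarTimes, kbarUnitsToTimes, ⟨kbarTimes_gal⟩, ⟨kbarUnits_gal⟩,
    fun C => ⟨timesObj_actionKer C, unitsObj_actionKer C⟩, fun _ => ⟨rfl, rfl⟩⟩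

end MLFClosure

end Literature.AnabelianGeometry.AbsoluteAnabelian

end
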